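import Summits.HodgeConjecture.HodgeConjecture.Theses.TropicalWeilObstruction
import Literature.AlgebraicGeometry.Motives.HyperbolicWeilType

/-!
# `MumfordWeilShadow` — birth skeleton (line `birth`)

Crux `Summit.HodgeConjecture.HodgeConjecture.Theses.TropicalWeilObstruction.MumfordWeilShadow`
(item `stmt-HodgeConjecture-18479`, rank 3 of route `TropicalWeilObstruction`): for every very
general tropical Weil period `Q` there is a complex abelian eightfold `(A, φ)`, `φ ≫ φ = -𝟙`, with a
cup-non-degenerate rational `(4,4)`-triple `u₀, u₁, u₂` (`u₁, u₂` in the Weil plane) such that every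
cup-non-degenerate family of `m` rational ALGEBRAIC `(4,4)`-classes on `A` casts `m` `ℚ`-independent
effective tropical `4`-cycle classes on `X_Q = ℝ⁸ / Q·ℤ⁸`.

The line splits the crux into the three theorems it is made of — one per area — and a kernel-checked
assembly `MumfordWeilShadow_of`:

* `stub_mumfordWeilFibre` (XL, degeneration theory — the transfer engine). Over every such `Q` sits
  the very general fibre `A` of the Mumford–Weil family near the totally degenerate `ℤ[i]`-cusp with
  tropical limit `X_Q`: an abelian eightfold with `φ ≫ φ = -𝟙` which is HYPERBOLIC
  (`Motives.IsHyperbolicWeilType` for the `K`-symmetrised hyperplane class `e^*a + φ^*e^*a` of some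
  projective embedding `e` and rational `a ≠ 0`: the toric part `W₀H¹` is a rational `φ^*`-stable
  Lagrangian `8`-frame), together with a SPECIALISATION MAP `ι : H⁸(A(ℂ); ℂ) → ⋀⁴ℝ⁸ ⊗ ⋀⁴ℝ⁸`
  (the projection of the monodromy-invariant part `⋂ ker Nⱼ ⊆ W₈` to `Gr^W₈ H⁸ = ⋀⁴Gr₀H¹ ⊗ ⋀⁴Gr₂H¹
  ≅ ⋀⁴(Qℤ⁸) ⊗ ⋀⁴ℤ⁸ ⊗ ℚ`, Ikenmeyer–Katz–Mikhalkin–Zharkov, *Tropical homology*, Thm. 1: tropical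
  `(p,q)`-homology = `Gr^W_{2p} H^{p+q}` of the limit MHS) which is (L) `ℚ`-linear on rational
  algebraic families, (N) NUMERICALLY INJECTIVE there — a `ℚ`-combination of rational algebraic
  classes with `ι = 0` lies in `W₆`, hence cups to `0 ∈ H¹⁶ = Gr^W₁₆` against every rational
  algebraic class — and (E) EFFECTIVE: every rational algebraic class specialises into the `ℚ`-span
  of the classes `cyc Z` of effective tropical `4`-cycles on `X_Q` (tropicalisation of an effective
  cycle on a totally degenerate abelian variety is a `Γ`-rational balanced polytopal complex of the
  same dimension: Gubler, *Tropical varieties for non-archimedean analytic spaces*, Thm. 6.9; class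
  compatibility `[Trop Z] = ι(cl Z)` is the unpublished part, over a value group of rational rank 16).
* `stub_weilHodgeTriple` (L, Hodge theory of Weil type). On every HYPERBOLIC `(A, φ)` of dimension
  `8` with `φ ≫ φ = -𝟙` there is a cup-non-degenerate rational `(4,4)`-triple `u` with `u₁, u₂` in the
  Weil plane `weilClassesOf A φ 4 1`: `u₀ = h⁴` (`h` the `K`-symmetrised hyperplane class),
  `u₁, u₂` a rational basis of the Weil plane (`weilClassesOf_eq_span_isRationalClass`,
  `finrank_weilClassesOf_eq_two`), type `(4,4)` by hyperbolic ⇒ balanced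
  (`isOfHodgeType_of_mem_weilClassesOf_of_isHyperbolicWeilType`, Deligne LNM 900 Thm. 4.8 /
  Prop. 4.4); non-degeneracy: `h⁸ ≠ 0`, `h⁴ ⌣ E± = 0` and `E₊ ⌣ E₊ = E₋ ⌣ E₋ = 0` by comparing the
  characters `(x² + y²)⁴(x ± iy)⁸`, `(x ± iy)¹⁶` with `deg (x·𝟙 + y·φ) = (x² + y²)⁸` on `H¹⁶`, and
  `E₊ ⌣ E₋ = ⋀⁸V₊ ∧ ⋀⁸V₋ = H¹⁶ ≠ 0` (van Geemen LNM 1594, 4.9–4.11, proof of Thm. 6.12).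
* `stub_extractEffective` (M, linear algebra). `m` `ℚ`-independent vectors in the `ℚ`-span of the
  effective cycle classes are witnessed by `m` effective cycles with `ℚ`-independent classes
  (exchange lemma: the span has rank `≥ m`, so `range cyc` contains `m` independent vectors).
* `MumfordWeilShadow_of` (proved here): fibre + triple; for a cup-non-degenerate rational algebraic
  family `a`, (L) + (N) + non-degeneracy give `ℚ`-independence of `ι ∘ a`, (E) puts it in the
  effective span, and extraction yields the `m` cycles.

Disproof used: none relevant (no `Disproof.lean` / Negative lemma is filed on this crux; `ledger
negatives --problem HodgeConjecture` lists three unrelated refutations).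
-/

namespace Summit.HodgeConjecture.HodgeConjecture.Cruxes.MumfordWeilShadow.Birth

open CategoryTheory
open Literature.AlgebraicGeometry Literature.AlgebraicGeometry.Motives
open Literature.AlgebraicGeometry.HodgeTheory Literature.AlgebraicGeometry.Tropical
open Literature.AlgebraicTopology.SingularHomology
open Summit.HodgeConjecture.HodgeConjecture.Theses.TropicalWeilObstruction
open scoped BigOperators

/-- **Stub (XL) — the Mumford–Weil fibre and its specialisation map.** For every positive definite
`Q` commuting with `J = weilJ 4` whose `16` free entries are algebraically independent over `ℚ`
there are a complex abelian eightfold `A`, `φ : A ⟶ A` with `φ ≫ φ = -𝟙`, a projective embedding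
`e`, a non-zero rational `a ∈ H²(ℙᴺ(ℂ); ℂ)` with `(A, φ)` HYPERBOLIC for `e^*a + φ^*e^*a`, and a map
`ι : H⁸(A(ℂ); ℂ) → ⋀⁴ℝ⁸ ⊗ ⋀⁴ℝ⁸` (Plücker coordinates) which on rational algebraic classes is
(L) `ℚ`-linear, (N) numerically injective (`ι (Σ lₖ aₖ) = 0 ⇒ (Σ lₖ aₖ) ⌣ a_{k'} = 0` for all `k'`)
and (E) effective (`ι c ∈ span_ℚ {cyc Z : Z effective tropical 4-cycle on ℝ⁸/Qℤ⁸}`).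
Intended witness: the very general fibre of the Mumford–Weil family with tropical limit `X_Q`,
`ι` = projection of `⋂ ker Nⱼ ⊆ W₈ H⁸` onto `Gr^W₈ ≅ ⋀⁴(Qℤ⁸) ⊗ ⋀⁴ℤ⁸ ⊗ ℚ` (IKMZ, Tropical homology,
Thm. 1), (E) by tropicalisation of effective cycles (Gubler 2007, Thm. 6.9) plus class
compatibility. -/
theorem stub_mumfordWeilFibre :
    ∀ Q : Matrix (Fin (2 * 4)) (Fin (2 * 4)) ℝ, Q.PosDef → Q * weilJ 4 = weilJ 4 * Q →
      IsWeilGeneric 4 Q →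
      ∃ (A : AbelianVariety ℂ) (φ : A ⟶ A) (e : ProjectiveEmbedding A.X)
        (a : complexBetti (projectiveSpace e.n ℂ) 2)
        (ι : complexBetti A.X (2 * 4) → ((Fin 4 → Fin (2 * 4)) → (Fin 4 → Fin (2 * 4)) → ℝ)),
        A.dim = 8 ∧ φ ≫ φ = -(𝟙 A) ∧ IsRationalClass a ∧ a ≠ 0 ∧
        IsHyperbolicWeilType A φ 4
          (complexBetti.map e.ι 2 a + complexBetti.map φ.hom.hom.hom 2 (complexBetti.map e.ι 2 a)) ∧
        (∀ (m : ℕ) (c : Fin m → complexBetti A.X (2 * 4)) (l : Fin m → ℚ),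
          (∀ k, IsRationalClass (c k)) → (∀ k, c k ∈ algebraicClasses A.X 4) →
          ι (∑ k, ((l k : ℚ) : ℂ) • c k) = ∑ k, l k • ι (c k)) ∧
        (∀ (m : ℕ) (c : Fin m → complexBetti A.X (2 * 4)) (l : Fin m → ℚ),
          (∀ k, IsRationalClass (c k)) → (∀ k, c k ∈ algebraicClasses A.X 4) →
          ι (∑ k, ((l k : ℚ) : ℂ) • c k) = 0 →
          ∀ k', cupProduct (show 2 * 4 + 2 * 4 = 16 by norm_num) (∑ k, ((l k : ℚ) : ℂ) • c k) (c k') = 0) ∧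
        (∀ c : complexBetti A.X (2 * 4), IsRationalClass c → c ∈ algebraicClasses A.X 4 →
          ι c ∈ Submodule.span ℚ (Set.range
            (TropicalTorusCycle.cyc : TropicalTorusCycle (2 * 4) 4 Q →
              (Fin 4 → Fin (2 * 4)) → (Fin 4 → Fin (2 * 4)) → ℝ))) := by
  sorry

/-- **Stub (L) — the cup-non-degenerate Weil–Hodge triple of a hyperbolic Weil eightfold.** For a
complex abelian eightfold `A` with `φ ≫ φ = -𝟙`, hyperbolic for the `K`-symmetrised hyperplane class
`e^*a + φ^*e^*a` (`a` rational, non-zero), there are rational `(4,4)`-classes `u₀, u₁, u₂ ∈ H⁸(A(ℂ); ℂ)`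
with `u₁, u₂ ∈ weilClassesOf A φ 4 1` whose `ℚ`-span is non-degenerate for the cup product into
`H¹⁶`: `u₀ = h⁴`, `u₁, u₂` a rational basis of the Weil plane; Hodge type by hyperbolic ⇒ balanced
(Deligne–Milne Thm. 4.8 / Prop. 4.4, `isOfHodgeType_of_mem_weilClassesOf_of_isHyperbolicWeilType`),
non-degeneracy from `h⁸ ≠ 0`, `E₊ ⌣ E₋ = H¹⁶`, and the vanishing of all other products by
eigen-characters of `(x·𝟙 + y·φ)^*` (van Geemen 4.9–4.11, proof of 6.12). -/
theorem stub_weilHodgeTriple :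
    ∀ (A : AbelianVariety ℂ) (φ : A ⟶ A) (e : ProjectiveEmbedding A.X)
      (a : complexBetti (projectiveSpace e.n ℂ) 2),
      A.dim = 8 → φ ≫ φ = -(𝟙 A) → IsRationalClass a → a ≠ 0 →
      IsHyperbolicWeilType A φ 4
        (complexBetti.map e.ι 2 a + complexBetti.map φ.hom.hom.hom 2 (complexBetti.map e.ι 2 a)) →
      ∃ u : Fin 3 → complexBetti A.X (2 * 4),
        (∀ k, IsRationalClass (u k) ∧ IsOfHodgeType 8 A.X (2 * 4) 4 4 (u k)) ∧
        u 1 ∈ weilClassesOf A φ 4 1 ∧ u 2 ∈ weilClassesOf A φ 4 1 ∧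
        (∀ l : Fin 3 → ℚ, l ≠ 0 →
          ∃ k', cupProduct (show 2 * 4 + 2 * 4 = 16 by norm_num) (∑ k, ((l k : ℚ) : ℂ) • u k) (u k') ≠ 0) := by
  sorry

/-- **Stub (M) — extracting independent effective cycles.** On any tropical torus `ℝ⁸ / Q·ℤ⁸`:
`m` `ℚ`-linearly independent vectors of `⋀⁴ℝ⁸ ⊗ ⋀⁴ℝ⁸` lying in the `ℚ`-span of the classes of
effective tropical `4`-cycles are matched by `m` effective tropical `4`-cycles with `ℚ`-linearly
independent classes (the span of `range cyc` has rank `≥ m`, so it has a basis inside `range cyc`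
with at least `m` elements). [folklore linear algebra] -/
theorem stub_extractEffective :
    ∀ (Q : Matrix (Fin (2 * 4)) (Fin (2 * 4)) ℝ) (m : ℕ)
      (v : Fin m → ((Fin 4 → Fin (2 * 4)) → (Fin 4 → Fin (2 * 4)) → ℝ)),
      LinearIndependent ℚ v →
      (∀ k, v k ∈ Submodule.span ℚ (Set.range
        (TropicalTorusCycle.cyc : TropicalTorusCycle (2 * 4) 4 Q →
          (Fin 4 → Fin (2 * 4)) → (Fin 4 → Fin (2 * 4)) → ℝ))) →
      ∃ c : Fin m → TropicalTorusCycle (2 * 4) 4 Q, LinearIndependent ℚ fun k => (c k).cyc := by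
  sorry

/-- **Assembly (proved).** `stub_mumfordWeilFibre`, `stub_weilHodgeTriple` and
`stub_extractEffective` imply the crux `MumfordWeilShadow` BY NAME: take the fibre `(A, φ, e, a, ι)`
over `Q` and its Weil–Hodge triple `u`; for a cup-non-degenerate rational algebraic family `a`,
a rational relation `Σ gₖ • ι(aₖ) = 0` gives `ι(Σ gₖ aₖ) = 0` by (L), hence `(Σ gₖ aₖ) ⌣ a_{k'} = 0`
for all `k'` by (N), so `g = 0` by non-degeneracy — `ι ∘ a` is `ℚ`-independent; by (E) it lies in
the effective span, and extraction gives the `m` effective cycles. -/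
theorem MumfordWeilShadow_of : MumfordWeilShadow := by
  intro Q hQ hQJ hgen
  obtain ⟨A, φ, e, a, ι, hdim, hφ, ha, ha0, hhyp, hlin, hnum, heff⟩ :=
    stub_mumfordWeilFibre Q hQ hQJ hgen
  obtain ⟨u, hu, hu1, hu2, hund⟩ := stub_weilHodgeTriple A φ e a hdim hφ ha ha0 hhyp
  refine ⟨A, φ, u, hdim, hφ, hu, hu1, hu2, hund, ?_⟩
  intro m a' hrat halg hnd
  have hli : LinearIndependent ℚ (fun k => ι (a' k)) := by
    rw [Fintype.linearIndependent_iff]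
    intro g hg
    by_contra hne
    push Not at hne
    obtain ⟨k₀, hk₀⟩ := hne
    have hg0 : g ≠ 0 := fun h => hk₀ (by simp [h])
    obtain ⟨k', hk'⟩ := hnd g hg0
    apply hk'
    apply hnum m a' g hrat halg
    rw [hlin m a' g hrat halg]
    exact hg
  have hmem : ∀ k, ι (a' k) ∈ Submodule.span ℚ (Set.range
      (TropicalTorusCycle.cyc : TropicalTorusCycle (2 * 4) 4 Q →
        (Fin 4 → Fin (2 * 4)) → (Fin 4 → Fin (2 * 4)) → ℝ)) :=
    fun k => heff (a' k) (hrat k) (halg k)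
  exact stub_extractEffective Q m (fun k => ι (a' k)) hli hmem

end Summit.HodgeConjecture.HodgeConjecture.Cruxes.MumfordWeilShadow.Birth
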